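import Summits.HodgeConjecture.HodgeConjecture.Cruxes.BlochSeedDiscOne.DepthBoundA4

/-!
# CycleDoorBudget — the cycle-door frame count (N4)_r against the one-orbit ∕ S₀ universe (plan-lens-HodgeAV-strengthen g15, STRENGTHEN-MEMO-23 §1 (4), §7)

Token: line stmt-HodgeConjecture-18881 Cruxes/BlochSeedDiscOne/Lines/birth.lean 814a6a70c14e831a stub_rung_pad4_seedAt.

LETTER-MODEL ARITHMETIC ONLY.  In the rank-`r₀` cokernel room (READING 1; c4-1 g2 `C4-DEGENERACY-LOCI` §0, §3 PROPOSITION FS) the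
Bloch-injectivity of the corank-one degeneracy locus `Z = D_{r₀-4}(V_ξ → 𝓔(t))` of a Pic⁰-generic frame needs
`ext²(𝓔,𝓔) + 28·(r₀ − 4) ≤ 3136` (MEMO-23 §1 (4), ×1); with the all-ample generic-atom E₁ count `ext² = 28·copies`
(colour-1 g2 l.6481 (ii)) this is the LETTER budget `copies + rank ≤ 116`.  This file records, sorry-free, that the budget is
`2·Σ_N m ≤ 116` (P-mass free) and that NO S₀-invariant (A4♯) ∧ (CONN) design with non-empty P-support and `8 ≤ rank` meets it:
`copies + rank ≥ 144` there (`DepthBoundA4.sumP_ge_64`).  So `CycleBudget116` below — the (N4)_r-under-all-ample-count hypothesis —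
empties the DB-SYM ∕ one-orbit universe with no search.  CAVEATS (MEMO-23 §1 (4)): for non-all-ample Hom patterns the E₁ count is
c4-1's Σ-H number, not `28·copies`; other frames with `c(V) = 1` may lower the frame term.  A budget line on a letter model ≠ sheaves ≠
a degeneracy locus ≠ a SEED; nothing here is proved toward HC ∕ HC_CM ∕ HC_AV ∕ №4 ∕ 26512 ∕ 18881 ∕ H2; `Nonex 14 199 8` stays REFUTED
as typed (RotatedPairB136); this is evidence for the audit «GEOMETRIC OR SPURIOUS?» (director-hodge R19.600–608), not a rung.
`import` of the data model only; no `axiom` ∕ `sorry` ∕ `instance` ∕ `unsafe` ∕ `native_decide`.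
-/

set_option linter.dupNamespace false
set_option autoImplicit false

namespace Summit.HodgeConjecture.HodgeConjecture.Cruxes.BlochSeedDiscOne.DepthBoundA4

namespace Design

/-- The cycle-door letter budget under the all-ample E₁ count: `28·copies + 28·(rank − 4) ≤ 3136`, i.e. `copies + rank ≤ 116`. -/
def CycleBudget116 (D : Design) : Prop := (D.copies : ℤ) + D.rank ≤ 116

/-- `copies + rank = 2·Σ_N m`: the P-mass cancels (it adds `28` per copy to `ext²` and subtracts `1` per copy from the rank). -/
theorem copies_add_rank (D : Design) :
    (D.copies : ℤ) + D.rank = 2 * ((D.N.map Prod.snd).sum : ℤ) := by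
  unfold copies rank
  push_cast
  ring

/-- The budget reads `Σ_N m ≤ 58`. -/
theorem cycleBudget116_iff (D : Design) : D.CycleBudget116 ↔ (D.N.map Prod.snd).sum ≤ 58 := by
  unfold CycleBudget116
  rw [copies_add_rank]
  omega

/-- `28·copies + 28·(rank − 4) ≤ 3136 ↔ CycleBudget116` (the frame count as MEMO-23 §1 (4) states it). -/
theorem frameCount_iff (D : Design) :
    28 * (D.copies : ℤ) + 28 * (D.rank - 4) ≤ 3136 ↔ D.CycleBudget116 := by
  unfold CycleBudget116
  constructor <;> intro h <;> omega

/-- Under S₀-invariance, (A4♯), (CONN), height 14 and a non-empty P-support, `8 ≤ rank` forces `copies + rank ≥ 144`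
(`Σ_P m ≥ 64` by `sumP_ge_64`, hence `Σ_N m ≥ 72`). -/
theorem copies_add_rank_ge_144 (D : Design) (hS : D.S0Invariant) (hA : D.OnAlphabet 14) (h4 : D.A4sharp)
    (hC : D.CONN) (x : Cell) (hx : x ∈ D.suppP) (hr : 8 ≤ D.rank) :
    144 ≤ (D.copies : ℤ) + D.rank := by
  have h64 := sumP_ge_64 D hS hA h4 hC x hx
  have h64' : (64 : ℤ) ≤ ((D.P.map Prod.snd).sum : ℤ) := by exact_mod_cast h64
  unfold rank at hr
  rw [copies_add_rank]
  omega

/-- THE DIGIT: no S₀-invariant (A4♯) ∧ (CONN) design at height 14 with non-empty P-support and `8 ≤ rank` meets the cycle-door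
letter budget — the DB-SYM ∕ one-orbit universe is empty at the cycle door (Pic⁰-generic frame, all-ample E₁ count) with no search. -/
theorem not_cycleBudget116_of_S0 (D : Design) (hS : D.S0Invariant) (hA : D.OnAlphabet 14) (h4 : D.A4sharp)
    (hC : D.CONN) (x : Cell) (hx : x ∈ D.suppP) (hr : 8 ≤ D.rank) : ¬ D.CycleBudget116 := by
  intro hB
  have h := copies_add_rank_ge_144 D hS hA h4 hC x hx hr
  unfold CycleBudget116 at hB
  omega

/-- The same as an emptiness statement in the shape of the route's letter lemmas. -/
theorem cycleDoor_S0_empty :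
    ∀ D : Design, D.S0Invariant → D.OnAlphabet 14 → D.A4sharp → D.CONN → (∃ x, x ∈ D.suppP) → 8 ≤ D.rank →
      D.CycleBudget116 → False := by
  intro D hS hA h4 hC ⟨x, hx⟩ hr hB
  exact not_cycleBudget116_of_S0 D hS hA h4 hC x hx hr hB

end Design

end Summit.HodgeConjecture.HodgeConjecture.Cruxes.BlochSeedDiscOne.DepthBoundA4
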